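import Mathlib
import HarnessLib

/-!
# Grid reduction of a supremum for a process with monotonically dominated increments
(line `hemisphere-affine-slaving`, crux `CollisionalTransferLocality`, stmt-AtomisticToContinuum-9518)

Helper file (`--supports stmt-AtomisticToContinuum-9518`; registered stub
`exists_grid_index_of_dominated_increments`) of the line lead (seat c6). Pure real analysis, Mathlib only.

* `exists_grid_index_mem_Icc` — every `τ ∈ [0, t]` lies in a cell `[k t/n, (k+1) t/n]` of the uniform grid
  with `k < n` (`k = ⌊τ / (t/n)⌋₊` for `τ < t`, `k = n - 1` for `τ = t`);
* `exists_grid_index_of_dominated_increments` (registered) — THE GRID STEP of the `sup_τ` argument: if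
  `|J τ' − J τ| ≤ C (V τ' − V τ)` for `0 ≤ τ ≤ τ' ≤ t` with `V` monotone on `[0, t]` and `C ≥ 0`, and `R` has
  modulus `ρ` at scale `t/n` on `[0, t]`, then for every `τ ∈ [0, t]` there is a grid index `k < n` with
  `|J τ − R τ| ≤ |J τ_k − R τ_k| + C (V τ_{k+1} − V τ_k) + ρ`, `τ_k = k t/n`
  (triangle inequality through `τ_k`, then monotonicity of `V` on `τ ≤ τ_{k+1} ≤ t`).
-/

namespace Summit.AtomisticToContinuum.HydrodynamicLimit.Theorems.HemisphereAffineSlaving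

open scoped BigOperators Topology Classical ENNReal InnerProductSpace
open Filter Set Function MeasureTheory

noncomputable section

/-- Every point of `[0, t]` lies in a cell `[k t/n, (k+1) t/n]` of the uniform grid of mesh `t/n`, with
`k < n`: for `τ < t` take `k = ⌊τ / (t/n)⌋₊`, for `τ = t` take `k = n - 1`. -/
theorem exists_grid_index_mem_Icc {t : ℝ} {n : ℕ} (ht : 0 < t) (hn : 0 < n) {τ : ℝ}
    (hτ : τ ∈ Icc 0 t) :
    ∃ k : ℕ, k < n ∧ (k : ℝ) * (t / n) ≤ τ ∧ τ ≤ ((k : ℝ) + 1) * (t / n) := by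
  have hn' : (0 : ℝ) < n := Nat.cast_pos.2 hn
  have hh : 0 < t / n := div_pos ht hn'
  have hnt : (n : ℝ) * (t / n) = t := mul_div_cancel₀ t hn'.ne'
  rcases hτ.2.lt_or_eq with hlt | heq
  · -- interior point: the floor cell
    have h0 : 0 ≤ τ / (t / n) := div_nonneg hτ.1 hh.le
    refine ⟨⌊τ / (t / n)⌋₊, ?_, ?_, ?_⟩
    · rw [Nat.floor_lt h0, div_lt_iff₀ hh, hnt]
      exact hlt
    · have h1 := Nat.floor_le h0
      rwa [le_div_iff₀ hh] at h1
    · have h1 := (Nat.lt_floor_add_one (τ / (t / n))).le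
      rwa [div_le_iff₀ hh] at h1
  · -- right endpoint: the last cell
    have h1n : 1 ≤ n := hn
    refine ⟨n - 1, Nat.sub_lt hn one_pos, ?_, ?_⟩
    · rw [Nat.cast_sub h1n, Nat.cast_one, sub_mul, hnt, one_mul, heq]
      linarith
    · rw [Nat.cast_sub h1n, Nat.cast_one, sub_add_cancel, hnt, heq]

/-- [G] grid reduction of a supremum for a process with monotonically dominated increments. -/
theorem exists_grid_index_of_dominated_increments : ∀ {t C ρ : ℝ} {n : ℕ}, 0 < t → 0 < n → 0 ≤ C → ∀ (J V R : ℝ → ℝ), MonotoneOn V (Icc 0 t) → (∀ τ τ' : ℝ, 0 ≤ τ → τ ≤ τ' → τ' ≤ t → |J τ' - J τ| ≤ C * (V τ' - V τ)) → (∀ τ ∈ Icc 0 t, ∀ τ' ∈ Icc 0 t, |τ' - τ| ≤ t / n → |R τ' - R τ| ≤ ρ) → ∀ τ ∈ Icc 0 t, ∃ k : ℕ, k < n ∧ |J τ - R τ| ≤ |J (k * (t / n)) - R (k * (t / n))| + C * (V ((k + 1) * (t / n)) - V (k * (t / n))) + ρ := by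
  intro t C ρ n ht hn hC J V R hV hJ hR τ hτ
  obtain ⟨k, hkn, hk1, hk2⟩ := exists_grid_index_mem_Icc ht hn hτ
  refine ⟨k, hkn, ?_⟩
  have hn' : (0 : ℝ) < n := Nat.cast_pos.2 hn
  have hh : 0 < t / n := div_pos ht hn'
  have hnt : (n : ℝ) * (t / n) = t := mul_div_cancel₀ t hn'.ne'
  -- the cell `[τ_k, τ_{k+1}] ⊆ [0, t]`
  have hk0 : 0 ≤ (k : ℝ) * (t / n) := mul_nonneg k.cast_nonneg hh.le
  have hk1n : (k : ℝ) + 1 ≤ n := by exact_mod_cast Nat.succ_le_of_lt hkn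
  have hk1t : ((k : ℝ) + 1) * (t / n) ≤ t := by
    calc ((k : ℝ) + 1) * (t / n) ≤ n * (t / n) := mul_le_mul_of_nonneg_right hk1n hh.le
      _ = t := hnt
  -- the three pieces of the triangle inequality through `τ_k`
  have h1 : |J τ - J (k * (t / n))| ≤ C * (V τ - V (k * (t / n))) := hJ _ _ hk0 hk1 hτ.2
  have h2 : V τ ≤ V ((k + 1) * (t / n)) :=
    hV hτ ⟨mul_nonneg (by positivity) hh.le, hk1t⟩ hk2
  have h3 : |R (k * (t / n)) - R τ| ≤ ρ := by
    refine hR τ hτ _ ⟨hk0, hk1.trans hτ.2⟩ ?_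
    rw [abs_sub_comm, abs_of_nonneg (sub_nonneg.2 hk1)]
    have : ((k : ℝ) + 1) * (t / n) = k * (t / n) + t / n := by ring
    linarith
  have htri : |J τ - R τ| ≤
      |J τ - J (k * (t / n))| + |J (k * (t / n)) - R (k * (t / n))| + |R (k * (t / n)) - R τ| := by
    have h := abs_add_three (J τ - J (k * (t / n))) (J (k * (t / n)) - R (k * (t / n)))
      (R (k * (t / n)) - R τ)
    rwa [show J τ - J (k * (t / n)) + (J (k * (t / n)) - R (k * (t / n))) + (R (k * (t / n)) - R τ)
      = J τ - R τ by ring] at h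
  have hmono : C * (V τ - V (k * (t / n))) ≤ C * (V ((k + 1) * (t / n)) - V (k * (t / n))) :=
    mul_le_mul_of_nonneg_left (sub_le_sub_right h2 _) hC
  linarith

end

end Summit.AtomisticToContinuum.HydrodynamicLimit.Theorems.HemisphereAffineSlaving
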